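import Literature.NumberTheory.EllipticCurves.YanZhu2026.TwoVariableMainTheorems
import HarnessLib

/-!
# Yan–Zhu 2026 (J. Algebra 693 = arXiv:2412.20078v4), §3.3 "Cyclotomic `p`-adic `L`-function":
# Proposition 3.7 — `𝓛_p^PR(E/K)⁺ = 𝓛_p^MSD(E/ℚ) · 𝓛_p^MSD(E^K/ℚ)` up to a unit of `Λ_ℚ` — typed in the
# tree's period normalisation (hence up to `p^ℤ · Λ_ℚˣ`, gen 2) AND at print strength (one unit, Néron
# normalisation through `ϖ, ϖ'`, gen 6), and Proposition 3.8 — `𝓛_p^PR(E/K) ≠ 0`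

Source: Xiaojun Yan, Xiuwu Zhu, *Main conjectures for non-CM elliptic curves at good ordinary primes*,
J. Algebra **693** (2026) 372–402 = arXiv:2412.20078; locators of the arXiv **v4** TeX (journal
numbering; `run/shared/lean/b2b/bsd-rank1-residual/b2b-bsdres-lit/g98/eprints/yz_v4/main.tex`): §3.3
l.795–836 — Thm. 3.6 (`𝓛_p^MSD`, = [CGS, Thm. 2.1.1]) l.803–815, "`𝓛_p^PR(E/K)⁺ ∈ Λ_ℚ ≃ Λ_K⁺` the image
of `𝓛_p^PR(E/K)` under the map induced by the projection `Γ_K ↠ Γ_K⁺ ≃ Γ_ℚ`" l.819, **Prop. 3.7**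
(`\label{PR-MSD}`) l.821–829, **Prop. 3.8** (`\label{non1}`) l.831–836; = arXiv v2 Props. 3.7, 3.8
[corpus:paper:arxiv-2412.20078 p0009]. Bib key `YanZhu2024MainConjNonCM`. Cell `pub/bsd-littype` (typing
layer D-0088(4)), seat `bsd-littype-04` (gen 2). Companion of `TwoVariableMainTheorems.lean` (the
carriers `IsHidaRankinLFunction`, `perrinRiouLFunction`, `IwasawaAlgebra₂.toPlus`), which it anchors to
the tree's ONE-variable `p`-adic `L`-functions (`padicLFunction`, `padicLFunctionEK`).

## The printed statements (v4, verbatim)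

Thm. 3.6: "There exists an element `𝓛_p^MSD(E/ℚ) ∈ Λ_ℚ` such that for every finite-order character `χ`
of `Γ_ℚ`, `𝓛_p^MSD(E/ℚ)(χ) = p^r/(g(χ̄)α_p^r) · L(E, χ̄, 1)/Ω_E^+` (`χ` of conductor `p^r ≠ 1`),
`= (1 - α_p⁻¹)² · L(E,1)/Ω_E^+` (`χ = 1`)", `Ω_E^±` the NÉRON periods (l.797–799).

"**Proposition 3.7.** We have `𝓛_p^PR(E/K)⁺ = 𝓛_p^MSD(E/ℚ) · 𝓛_p^MSD(E^K/ℚ)`, up to a unit in `Λ_ℚˣ`."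
(Proof: "See [CGS, Proposition 2.2.4].")

"**Proposition 3.8.** Both `𝓛_p^MSD(E/ℚ)` and `𝓛_p^PR(E/K)` are non-vanishing." (Proof: Rohrlich for
`𝓛_p^MSD(E/ℚ)` and `𝓛_p^MSD(E^K/ℚ)`, then Prop. 3.7.)

Setting: §3.2 ("`E/ℚ` an elliptic curve with good ordinary reduction at the prime `p`", l.755) over the
standing §2 data (`K` imaginary quadratic, `p > 2` split in `K`, `(N, D_K) = 1`, l.440–442, l.468).

## Transcription, and why Prop. 3.7 is typed up to `p^ℤ · Λ_ℚˣ` (WEAKER than print)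

The tree's one-variable function `padicLFunction f α` (`α = unitRoot W p`) is the Mazur–Tate–Teitelbaum
function of the newform `f` normalised by the period `Ω_f^+` of `f` (`IsPAdicLFunctionOf`, file
`PAdicBSD`), whereas the source's `𝓛_p^MSD(E/ℚ)` is normalised by the Néron period `Ω_E^+`: the two
differ by the rational constant `ϖ_E = Ω_f^+/Ω_E^+ ∈ ℚˣ = p^ℤ · ℤ_pˣ` (module docstring of
`YanZhu2026/CyclotomicMainTheoremRational.lean`, "Normalisations" of `PAdicBSD`); the tree has no carrier
for `ϖ_E` or for the Néron-normalised function. Hence "`= 𝓛_p^MSD(E)·𝓛_p^MSD(E^K)` up to `Λ_ℚˣ`" is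
typed as "`= padicLFunctionEK` up to `p^k · Λ_ℚˣ`, `k ∈ ℤ`" — `padicLFunctionEK W p K hf hg = L_p(f, α) ·
L_p(g, χ_K(p)α)` (file `PAdicLFunctionK`, `g` the newform of the quadratic twist `E^K = W^{(D_K)}`; for
`p` split `χ_K(p)α = α`), the constant units `ϖ_E ϖ_{E^K} / p^{v_p(ϖ_E ϖ_{E^K})} ∈ ℤ_pˣ ⊂ Λ_ℚˣ` being
absorbed in the unit. The projection `Λ_K → Λ_K⁺` is, on the `ℚ_p⟦T⟧⟦S⟧` side, the tree's `cycRestrict`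
(kill the INNER variable `T = γ₂ − 1`; `(κ₁, κ₂)` THE cyclotomic/anticyclotomic pair, `γ₂ = γ⁻`), and
`Λ_K⁺ ≃ Λ_ℚ` (`Γ_K⁺ ≃ Γ_ℚ`, l.450) matches the outer variable `S = γ₁ − 1` with the variable
`S = γ_cyc − 1` of `padicLFunction` exactly when `γ₁|_{ℚ̄}` "matches the cyclotomic variable"
(`IsCyclotomicVariable p (absGaloisRestrict ℚ K γ₁)`: `χ_p(γ₁|) · ζ = γ_cyc`, the hypothesis of the
tree's one-variable main-conjecture facts `thm49_…`, bsd.S20/S21). The complex values of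
`IsHidaRankinLFunction` are transported by the embedding datum `ι`, those of `padicLFunction` are
`p`-adic modular symbols; the comparison (Birch's formula, [CGS, Prop. 2.2.4]) is `ι`-equivariant on
algebraic parts, so the statement is made for every `ι`.

Prop. 3.8 is typed for `𝓛_p^PR(E/K)` only (`perrinRiouLFunction W π F ≠ 0` for the characterised `F`);
its `𝓛_p^MSD(E/ℚ)` half is the tree's Rohrlich assembly `padicLFunction_ne_zero_of_rohrlich`
(`PAdicLFunctionProofs`) and is not restated.

Nothing is asserted (D-0014): two named facts, no `_holds`.

## GEN 6 ADDENDUM (2026-08-27, seat `bsd-littype-04` gen 6): Prop. 3.7 AT PRINT STRENGTH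

The paragraph above records why gen 2 typed Prop. 3.7 only up to `p^ℤ · Λ_ℚˣ`: it saw no carrier for
the Néron-period normalisation. The tree DOES carry that normalisation, in the form already used by
`YanZhu2026.thm49_charIdeal_eq_padicLFunction_integral`, by `kato`/Wuthrich facts and — for this very
Proposition, which [CGS] prints as their Prop. 2.2.4 — by
`CastellaGrossiSkinner2025.thm723_charIdeal_eq_padicLFunction_mul` (file
`CastellaGrossiSkinner2025/PerrinRiouMainConjecture.lean`, transcription item 5): a rational `ϖ` with
`ϖ · Ω_E = Ω⁺_f` (`(ϖ : ℝ) * W.realPeriodRat = plusPeriod f`), so that `ϖ · L_p(f, α)` IS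
`𝓛_p^MSD(E/ℚ)` for the real period `Ω_E = W.realPeriodRat` of the globally minimal model (`= c_∞ · Ω_E⁺`,
`c_∞ ∈ {1, 2}` the number of real components — a unit of `ℤ_p` at odd `p`, absorbed in the unit of the
statement); and for the twist `E^K` a globally minimal model `W'` (`∃ C, C • W' = W.quadraticTwist d_K`)
with newform `g` and ratio `ϖ'` (`ϖ' · Ω_{E^K} = Ω⁺_g`), `α_p(E^K) = unitRoot W' p`. The section
"Prop. 3.7 at print strength" below therefore vendors the Proposition EXACTLY as printed — ONE unit
`u ∈ Λ_ℚˣ`, no power of `p` — as `prop37_cycRestrict_perrinRiou_eq_padicLFunction_mul`, binder for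
binder the gen-2 fact with the conclusion `cycRestrict (𝓛_p^PR) = ι(u) · C(ϖϖ') · (L_p(f_E, α) ·
L_p(g, α'))`, the right-hand side being VERBATIM that of `thm723_…` (same Prop. 2.2.4, same reading:
the unit of [CGS, Prop. 2.2.4] — e.g. the group-like element interpolating `χ(|D_K|)`, [CGS] proof
l.862 — and the `c_∞`'s are absorbed in `u`). The gen-2 fact `…_rat` is kept unchanged for its
consumers (`cycRestrict_perrinRiou_eq_zero_iff_of_prop37`); it is the WEAKER reading, the new one is
FAITHFUL. Consumer: the (Im)-equality clause of Thm. 4.2 (1) (printed proof, v4 l.1050–1056: "[Kato,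
Thm. 17.4], Lemma 5.3 and a commutative algebra lemma [SU14, Lemma 3.2]"), whose Skinner–Urban step
needs the comparison up to a UNIT of `Λ_ℚ` and fails with a power of `p` (OPEN-QUESTIONS-04 Q24 (b));
replayed in the sibling `YanZhu2026/OrdinaryMainConjectureEqualityProofs.lean`. This addendum adds
exactly ONE named fact and two proved unfoldings; nothing else is minted.

## References
* X. Yan, X. Zhu, J. Algebra 693 (2026) = arXiv:2412.20078v4, §3.3 l.795–836 (Thm. 3.6, Props. 3.7, 3.8).
* F. Castella, G. Grossi, C. Skinner, Math. Ann. 393 (2025), Thm. 2.1.1, Prop. 2.2.4.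
* D. Rohrlich, Invent. Math. 75 (1984) (non-vanishing of `L(E, χ, 1)`; tree `padicLFunction_ne_zero_of_rohrlich`).
* B. Perrin-Riou, Invent. Math. 89 (1987), §1 (1.1) — tree `padicLFunctionEK` (`PAdicLFunctionK.lean`).
-/

set_option autoImplicit false

noncomputable section

open scoped Classical

open PowerSeries NumberField IsDedekindDomain Field CongruenceSubgroup
  Literature.NumberTheory.GaloisRepresentations Literature.NumberTheory.EllipticCurves
  Literature.NumberTheory.EllipticCurves.ModularForms Literature.NumberTheory.EllipticCurves.Rank1Residual

universe u

namespace Literature.NumberTheory.EllipticCurves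

namespace IwasawaAlgebra₂

variable (p : ℕ) [Fact p.Prime]

/-- **Restriction to the cyclotomic line commutes with `Λ_K ↪ ℚ_p⟦T⟧⟦S⟧`**: killing the inner variable
of `ι(G)` (`cycRestrict`) is `ι` of the projection `Λ_K → Λ_K⁺` (`toPlus`) — the map "induced by the
projection `Γ_K ↠ Γ_K⁺`" under which `𝓛_p^PR(E/K) ↦ 𝓛_p^PR(E/K)⁺` (l.819).
[cite: YanZhu2024MainConjNonCM, §3.3 (𝓛_p^PR(E/K)⁺, arXiv:2412.20078v4 TeX l.819)] -/
theorem cycRestrict_toCycAnti (G : IwasawaAlgebra₂ p) :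
    cycRestrict (toCycAnti p G) = iwasawaToPowerSeries p (toPlus p G) := by
  ext n
  rw [coeff_cycRestrict, cycTaylorCoeff, ← PowerSeries.coeff_zero_eq_constantCoeff_apply,
    coeff_coeff_toCycAnti]
  simp [toPlus, iwasawaToPowerSeries, PowerSeries.coeff_map]

end IwasawaAlgebra₂

end Literature.NumberTheory.EllipticCurves

namespace Literature.NumberTheory.EllipticCurves.YanZhu2026

open IwasawaAlgebra₂

/-- **Yan–Zhu, J. Algebra 693 (2026), Proposition 3.7 (arXiv v4 l.821–829; = [CGS, Prop. 2.2.4]) —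
`𝓛_p^PR(E/K)⁺ = 𝓛_p^MSD(E/ℚ) · 𝓛_p^MSD(E^K/ℚ)` up to a unit of `Λ_ℚ` — typed in the tree's period
normalisation, i.e. up to `p^ℤ · Λ_ℚˣ` (WEAKER than print; module docstring).** Verbatim: "We have
`𝓛_p^PR(E/K)⁺ = 𝓛_p^MSD(E/ℚ) · 𝓛_p^MSD(E^K/ℚ)`, up to a unit in `Λ_ℚˣ`", `𝓛_p^PR(E/K)⁺ ∈ Λ_ℚ ≃ Λ_K⁺` the
image of `𝓛_p^PR(E/K)` under `Γ_K ↠ Γ_K⁺ ≃ Γ_ℚ`. Transcription: setting of §3.2 over §2 (`W` a globally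
minimal model of `E/ℚ` of conductor `N` = the level of the parametrisation `π`, `3 ≤ p`, `GoodOrd W p`,
`K` imaginary quadratic, `p` split, `(N, D_K) = 1`); `(κ₁, κ₂)` THE cyclotomic and anticyclotomic
`ℤ_p`-extensions of `K` with an adapted generator pair `(γ₁, γ₂)` whose `γ₁` matches the cyclotomic
variable of `padicLFunction` (`IsCyclotomicVariable p (absGaloisRestrict ℚ K γ₁)`); `g` the newform of the
quadratic twist `E^K = W^{(D_K)}`; conclusion: for every `F = 𝓛_p^I(f_E/K)` (`IsHidaRankinLFunction ι W κ₁
κ₂ π.f F`) there are a unit `u ∈ Λ_ℚˣ` and `k ∈ ℤ` with `cycRestrict (𝓛_p^PR) = p^k · ι(u) ·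
padicLFunctionEK` in `ℚ_p⟦S⟧` (`padicLFunctionEK = L_p(f, α) · L_p(g, α)`, `α = unitRoot W p`, for split
`p`). [cite: YanZhu2024MainConjNonCM, Prop. 3.7 (§3.3, arXiv:2412.20078v4 TeX l.821–829) with l.819 (𝓛_p^PR(E/K)⁺) and Thm. 3.6 l.803–815; = arXiv v2 Prop. 3.7 [corpus:paper:arxiv-2412.20078 p0009]]
[cite: PerrinRiou1987, §1 (1.1) (the factorisation on the cyclotomic line; tree `padicLFunctionEK`)] -/
def prop37_cycRestrict_perrinRiou_eq_padicLFunctionEK_rat : Prop :=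
  ∀ {p : ℕ} [Fact p.Prime] (ι : integralClosure ℚ ℂ →+* ℂ_[p]) (W : WeierstrassCurve ℚ) [W.IsElliptic]
    [W.IsGloballyMinimal] (K : Type) [Field K] [NumberField K] (κ₁ κ₂ : ZpExtension K p)
    (γ₁ γ₂ : absoluteGaloisGroup K) [Fact (ZpExtension.IsTopGeneratorPair κ₁ κ₂ γ₁ γ₂)]
    {N N' : ℕ} [NeZero N] [NeZero N'] (π : ModularParametrizationData W N)
    {g : CuspForm (Gamma0 N') 2} (hg : IsNewformOf (W.quadraticTwist (NumberField.discr K : ℚ)) g),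
    3 ≤ p → GoodOrd W p → IsImaginaryQuadratic K →
      ((Ideal.span {(p : ℤ)}).primesOver (𝓞 K)).ncard = 2 → IsCoprime (N : ℤ) (NumberField.discr K) →
      κ₁.IsCyclotomic → κ₂.IsAnticyclotomic → IsCyclotomicVariable p (absGaloisRestrict ℚ K γ₁) →
    ∀ F : CycAntiSeries p, IsHidaRankinLFunction ι W κ₁ κ₂ π.f F →
      ∃ (u : (IwasawaAlgebra p)ˣ) (k : ℤ),
        cycRestrict (perrinRiouLFunction W π F) =
          PowerSeries.C ((p : ℚ_[p]) ^ k) * iwasawaToPowerSeries p (u : IwasawaAlgebra p) *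
            padicLFunctionEK W p K π.isNewformOf hg

/-- **Yan–Zhu, J. Algebra 693 (2026), Proposition 3.8, second half (arXiv v4 l.831–836):
`𝓛_p^PR(E/K)` is non-vanishing** (proof: Rohrlich's non-vanishing of `𝓛_p^MSD(E/ℚ)` and `𝓛_p^MSD(E^K/ℚ)`
+ Prop. 3.7). Verbatim: "Both `𝓛_p^MSD(E/ℚ)` and `𝓛_p^PR(E/K)` are non-vanishing." Transcription:
setting as in `prop37_…` without the cyclotomic-variable data (the statement is basis-free); conclusion:
every `F` with `IsHidaRankinLFunction ι W κ₁ κ₂ π.f F` has `perrinRiouLFunction W π F ≠ 0`. The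
`𝓛_p^MSD(E/ℚ)` half is the tree's `padicLFunction_ne_zero_of_rohrlich` (not restated).
[cite: YanZhu2024MainConjNonCM, Prop. 3.8 (§3.3, arXiv:2412.20078v4 TeX l.831–836); = arXiv v2 Prop. 3.8 [corpus:paper:arxiv-2412.20078 p0009]] -/
def prop38_perrinRiou_ne_zero : Prop :=
  ∀ {p : ℕ} [Fact p.Prime] (ι : integralClosure ℚ ℂ →+* ℂ_[p]) (W : WeierstrassCurve ℚ) [W.IsElliptic]
    [W.IsGloballyMinimal] (K : Type) [Field K] [NumberField K] (κ₁ κ₂ : ZpExtension K p)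
    (γ₁ γ₂ : absoluteGaloisGroup K) [Fact (ZpExtension.IsTopGeneratorPair κ₁ κ₂ γ₁ γ₂)]
    {N : ℕ} [NeZero N] (π : ModularParametrizationData W N),
    3 ≤ p → GoodOrd W p → IsImaginaryQuadratic K →
      ((Ideal.span {(p : ℤ)}).primesOver (𝓞 K)).ncard = 2 → IsCoprime (N : ℤ) (NumberField.discr K) →
    ∀ F : CycAntiSeries p, IsHidaRankinLFunction ι W κ₁ κ₂ π.f F → perrinRiouLFunction W π F ≠ 0

/-! ### Proved unfoldings -/

section API

variable {p : ℕ} [Fact p.Prime] {K : Type} [Field K] [NumberField K]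

/-- Under Prop. 3.7 (tree form), `𝓛_p^PR(E/K)⁺` vanishes iff `L_p(E/K, S) = L_p(f, α) L_p(g, α)` does:
`p^k` and the image of a unit of `Λ_ℚ` are non-zero-divisors of the domain `ℚ_p⟦S⟧` — the step of the
printed proof of Prop. 3.8 ("By Proposition 3.7, it follows that `𝓛_p^PR(E/K)⁺ ≠ 0`").
[cite: YanZhu2024MainConjNonCM, proof of Prop. 3.8 (arXiv:2412.20078v4 TeX l.834–836)] -/
theorem cycRestrict_perrinRiou_eq_zero_iff_of_prop37
    (h : prop37_cycRestrict_perrinRiou_eq_padicLFunctionEK_rat) (ι : integralClosure ℚ ℂ →+* ℂ_[p])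
    (W : WeierstrassCurve ℚ) [W.IsElliptic] [W.IsGloballyMinimal] (κ₁ κ₂ : ZpExtension K p)
    (γ₁ γ₂ : absoluteGaloisGroup K) [Fact (ZpExtension.IsTopGeneratorPair κ₁ κ₂ γ₁ γ₂)]
    {N N' : ℕ} [NeZero N] [NeZero N'] (π : ModularParametrizationData W N)
    {g : CuspForm (Gamma0 N') 2} (hg : IsNewformOf (W.quadraticTwist (NumberField.discr K : ℚ)) g)
    (hp : 3 ≤ p) (hord : GoodOrd W p) (hK : IsImaginaryQuadratic K)
    (hsplit : ((Ideal.span {(p : ℤ)}).primesOver (𝓞 K)).ncard = 2)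
    (hN : IsCoprime (N : ℤ) (NumberField.discr K)) (hκ₁ : κ₁.IsCyclotomic) (hκ₂ : κ₂.IsAnticyclotomic)
    (hγ₁ : IsCyclotomicVariable p (absGaloisRestrict ℚ K γ₁)) {F : CycAntiSeries p}
    (hF : IsHidaRankinLFunction ι W κ₁ κ₂ π.f F) :
    cycRestrict (perrinRiouLFunction W π F) = 0 ↔ padicLFunctionEK W p K π.isNewformOf hg = 0 := by
  obtain ⟨u, k, hk⟩ := h ι W K κ₁ κ₂ γ₁ γ₂ π hg hp hord hK hsplit hN hκ₁ hκ₂ hγ₁ F hF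
  have hp0 : (PowerSeries.C ((p : ℚ_[p]) ^ k) : PowerSeries ℚ_[p]) ≠ 0 :=
    (map_ne_zero_iff _ (PowerSeries.C_injective (R := ℚ_[p]))).mpr
      (zpow_ne_zero k (Nat.cast_ne_zero.mpr (Fact.out : p.Prime).ne_zero))
  have hu0 : iwasawaToPowerSeries p (u : IwasawaAlgebra p) ≠ 0 :=
    (u.isUnit.map (iwasawaToPowerSeries p)).ne_zero
  rw [hk]
  constructor
  · intro h0
    rcases mul_eq_zero.mp h0 with h1 | h1
    · rcases mul_eq_zero.mp h1 with h2 | h2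
      · exact absurd h2 hp0
      · exact absurd h2 hu0
    · exact h1
  · intro h0
    rw [h0, mul_zero]

end API

/-! ### Prop. 3.7 at print strength (gen 6): ONE unit of `Λ_ℚ`, Néron normalisation through `ϖ, ϖ'` -/

/-- **Yan–Zhu, J. Algebra 693 (2026), Proposition 3.7 AT PRINT STRENGTH (arXiv v4 l.821–829,
`\label{PR-MSD}`; = [CGS, Prop. 2.2.4]) — `𝓛_p^PR(E/K)⁺ = 𝓛_p^MSD(E/ℚ) · 𝓛_p^MSD(E^K/ℚ)` up to a unit
of `Λ_ℚ`, EXACTLY** (module docstring, GEN 6 ADDENDUM; supersedes in strength the gen-2 reading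
`prop37_cycRestrict_perrinRiou_eq_padicLFunctionEK_rat`, which is kept). Verbatim: "We have
`𝓛_p^PR(E/K)⁺ = 𝓛_p^MSD(E/ℚ) · 𝓛_p^MSD(E^K/ℚ)`, up to a unit in `Λ_ℚˣ`" (proof: "See [CGS,
Proposition 2.2.4]"), where (l.819) "`𝓛_p^PR(E/K)⁺ ∈ Λ_ℚ ≃ Λ_K⁺` [is] the image of `𝓛_p^PR(E/K)` under
the map induced by the projection `Γ_K ↠ Γ_K⁺ ≃ Γ_ℚ`" and (Thm. 3.6, l.803–815 = [CGS, Thm. 2.1.1])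
`𝓛_p^MSD(E/ℚ) ∈ Λ_ℚ` interpolates `p^r/(g(χ̄)α_p^r) · L(E, χ̄, 1)/Ω_E⁺` (`χ ≠ 1` of conductor `p^r`),
`(1 - α_p⁻¹)² · L(E,1)/Ω_E⁺` (`χ = 1`), `Ω_E^±` the NÉRON periods (l.797–799), `α_p` the unit root.
Transcription — binder for binder that of `…_rat` (setting of §3.2 over §2: `W` a globally minimal
model of `E/ℚ`, `π : ModularParametrizationData W N` a modular parametrisation `π_E : X₀(N) → E`
(`N = N_E`, `π.f = f_E`; Def. 3.4), `3 ≤ p`, `GoodOrd W p`, `K` imaginary quadratic, `p` split,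
`(N, D_K) = 1`; `(κ₁, κ₂)` THE cyclotomic/anticyclotomic pair with adapted generators `(γ₁, γ₂)`, `γ₁`
matching the cyclotomic variable of `padicLFunction` (`IsCyclotomicVariable p (absGaloisRestrict ℚ K
γ₁)`), so that `Λ_K → Λ_K⁺ ≃ Λ_ℚ` is `cycRestrict` on `ℚ_p⟦T⟧⟦S⟧`, `cycRestrict_toCycAnti`) — with the
two Mazur–Swinnerton-Dyer functions in the NÉRON normalisation of Thm. 3.6 exactly as in
`thm49_charIdeal_eq_padicLFunction_integral` and `CastellaGrossiSkinner2025.thm723_…`: a rational `ϖ`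
with `ϖ · Ω_E = Ω⁺_{f_E}` (`(ϖ : ℝ) * W.realPeriodRat = plusPeriod π.f`; `W.realPeriodRat = c_∞(E) ·
Ω_E⁺`, `c_∞ ∈ {1, 2}` a unit of `ℤ_p ⊂ Λ_ℚˣ` at odd `p`), and for "`E^K` the twist of `E` by the
quadratic character corresponding to `K/ℚ`" a globally minimal model `W'` (`∃ C, C • W' =
W.quadraticTwist d_K`) with newform `g` (`IsNewformOf W' g`, any level carrying it) and ratio `ϖ'`
(`ϖ' · Ω_{E^K} = Ω⁺_g`), `α_p(E^K) = unitRoot W' p` (`= α_p(E)`, `p` being split). Conclusion: for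
every `F = 𝓛_p^I(f_E/K)` (`IsHidaRankinLFunction ι W κ₁ κ₂ π.f F`) there is a unit `u ∈ Λ_ℚˣ` with
`cycRestrict (𝓛_p^PR(E/K)) = ι(u) · C(ϖϖ') · (L_p(f_E, α) · L_p(g, α'))` in `ℚ_p⟦S⟧` — the right-hand
side VERBATIM that of `thm723_charIdeal_eq_padicLFunction_mul` (the unit of [CGS, Prop. 2.2.4] and the
`c_∞`'s absorbed in `u`). FAITHFUL (one unit, no power of `p`); never stronger than print.
[cite: YanZhu2024MainConjNonCM, Prop. 3.7 (§3.3, arXiv:2412.20078v4 TeX l.821–829) with l.819 (𝓛_p^PR(E/K)⁺) and Thm. 3.6 (l.797–815, Néron periods); = arXiv v2 Prop. 3.7 [corpus:paper:arxiv-2412.20078 p0009]]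
[cite: CastellaGrossiSkinner2025, Prop. 2.2.4 (final TeX l.849–856; arXiv v1 Prop. 1.2.4) — the printed proof pointer, and Thm. 2.1.1 (𝓛_p^MSD, Néron period)] -/
def prop37_cycRestrict_perrinRiou_eq_padicLFunction_mul : Prop :=
  ∀ {p : ℕ} [Fact p.Prime] (ι : integralClosure ℚ ℂ →+* ℂ_[p]) (W : WeierstrassCurve ℚ) [W.IsElliptic]
    [W.IsGloballyMinimal] (K : Type) [Field K] [NumberField K] (κ₁ κ₂ : ZpExtension K p)
    (γ₁ γ₂ : absoluteGaloisGroup K) [Fact (ZpExtension.IsTopGeneratorPair κ₁ κ₂ γ₁ γ₂)]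
    {N : ℕ} [NeZero N] (π : ModularParametrizationData W N) (ϖ : ℚ)
    (W' : WeierstrassCurve ℚ) [W'.IsElliptic] [W'.IsGloballyMinimal]
    {N' : ℕ} [NeZero N'] (g : CuspForm (Gamma0 N') 2) (ϖ' : ℚ),
    3 ≤ p → GoodOrd W p → IsImaginaryQuadratic K →
      ((Ideal.span {(p : ℤ)}).primesOver (𝓞 K)).ncard = 2 → IsCoprime (N : ℤ) (NumberField.discr K) →
      κ₁.IsCyclotomic → κ₂.IsAnticyclotomic → IsCyclotomicVariable p (absGaloisRestrict ℚ K γ₁) →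
      (ϖ : ℝ) * W.realPeriodRat = plusPeriod π.f →
      (∃ C : WeierstrassCurve.VariableChange ℚ, C • W' = W.quadraticTwist (NumberField.discr K : ℚ)) →
      IsNewformOf W' g → (ϖ' : ℝ) * W'.realPeriodRat = plusPeriod g →
    ∀ F : CycAntiSeries p, IsHidaRankinLFunction ι W κ₁ κ₂ π.f F →
      ∃ u : (IwasawaAlgebra p)ˣ,
        cycRestrict (perrinRiouLFunction W π F) =
          iwasawaToPowerSeries p (u : IwasawaAlgebra p) *
            (PowerSeries.C ((ϖ * ϖ' : ℚ) : ℚ_[p]) *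
              (padicLFunction π.f (unitRoot W p : ℚ_[p]) * padicLFunction g (unitRoot W' p : ℚ_[p])))

section APIIntegral

variable {p : ℕ} [Fact p.Prime] {K : Type} [Field K] [NumberField K]

/-- Under Prop. 3.7 (print strength), `𝓛_p^PR(E/K)⁺` and `𝓛_p^MSD(E/ℚ) · 𝓛_p^MSD(E^K/ℚ)` (read as
`C(ϖϖ') · L_p(f_E, α) · L_p(g, α')`) are ASSOCIATED elements of `ℚ_p⟦S⟧` — the image `ι(u)` of a unit of
`Λ_ℚ` is a unit of `ℚ_p⟦S⟧`. [cite: YanZhu2024MainConjNonCM, Prop. 3.7 (arXiv:2412.20078v4 TeX l.821–829)] -/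
theorem associated_cycRestrict_perrinRiou_of_prop37_mul
    (h : prop37_cycRestrict_perrinRiou_eq_padicLFunction_mul) (ι : integralClosure ℚ ℂ →+* ℂ_[p])
    (W : WeierstrassCurve ℚ) [W.IsElliptic] [W.IsGloballyMinimal] (κ₁ κ₂ : ZpExtension K p)
    (γ₁ γ₂ : absoluteGaloisGroup K) [Fact (ZpExtension.IsTopGeneratorPair κ₁ κ₂ γ₁ γ₂)]
    {N : ℕ} [NeZero N] (π : ModularParametrizationData W N) {ϖ : ℚ}
    (W' : WeierstrassCurve ℚ) [W'.IsElliptic] [W'.IsGloballyMinimal]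
    {N' : ℕ} [NeZero N'] {g : CuspForm (Gamma0 N') 2} {ϖ' : ℚ}
    (hp : 3 ≤ p) (hord : GoodOrd W p) (hK : IsImaginaryQuadratic K)
    (hsplit : ((Ideal.span {(p : ℤ)}).primesOver (𝓞 K)).ncard = 2)
    (hN : IsCoprime (N : ℤ) (NumberField.discr K)) (hκ₁ : κ₁.IsCyclotomic) (hκ₂ : κ₂.IsAnticyclotomic)
    (hγ₁ : IsCyclotomicVariable p (absGaloisRestrict ℚ K γ₁))
    (hϖ : (ϖ : ℝ) * W.realPeriodRat = plusPeriod π.f)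
    (hW' : ∃ C : WeierstrassCurve.VariableChange ℚ, C • W' = W.quadraticTwist (NumberField.discr K : ℚ))
    (hg : IsNewformOf W' g) (hϖ' : (ϖ' : ℝ) * W'.realPeriodRat = plusPeriod g)
    {F : CycAntiSeries p} (hF : IsHidaRankinLFunction ι W κ₁ κ₂ π.f F) :
    Associated (cycRestrict (perrinRiouLFunction W π F))
      (PowerSeries.C ((ϖ * ϖ' : ℚ) : ℚ_[p]) *
        (padicLFunction π.f (unitRoot W p : ℚ_[p]) * padicLFunction g (unitRoot W' p : ℚ_[p]))) := by
  obtain ⟨u, hu⟩ := h ι W K κ₁ κ₂ γ₁ γ₂ π ϖ W' g ϖ' hp hord hK hsplit hN hκ₁ hκ₂ hγ₁ hϖ hW' hg hϖ' F hF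
  refine ⟨(Units.map (iwasawaToPowerSeries p : IwasawaAlgebra p →* PowerSeries ℚ_[p]) u)⁻¹, ?_⟩
  rw [hu, mul_comm (iwasawaToPowerSeries p (u : IwasawaAlgebra p)), mul_assoc, Units.coe_map_inv,
    MonoidHom.coe_coe, ← map_mul, Units.mul_inv, map_one, mul_one]

/-- Under Prop. 3.7 (print strength), `𝓛_p^PR(E/K)⁺` vanishes iff `ϖϖ' · L_p(f_E, α) · L_p(g, α')` does
— the step of the printed proof of Prop. 3.8 ("By Proposition 3.7, it follows that `𝓛_p^PR(E/K)⁺ ≠ 0`",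
l.834–836). [cite: YanZhu2024MainConjNonCM, proof of Prop. 3.8 (arXiv:2412.20078v4 TeX l.834–836)] -/
theorem cycRestrict_perrinRiou_eq_zero_iff_of_prop37_mul
    (h : prop37_cycRestrict_perrinRiou_eq_padicLFunction_mul) (ι : integralClosure ℚ ℂ →+* ℂ_[p])
    (W : WeierstrassCurve ℚ) [W.IsElliptic] [W.IsGloballyMinimal] (κ₁ κ₂ : ZpExtension K p)
    (γ₁ γ₂ : absoluteGaloisGroup K) [Fact (ZpExtension.IsTopGeneratorPair κ₁ κ₂ γ₁ γ₂)]
    {N : ℕ} [NeZero N] (π : ModularParametrizationData W N) {ϖ : ℚ}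
    (W' : WeierstrassCurve ℚ) [W'.IsElliptic] [W'.IsGloballyMinimal]
    {N' : ℕ} [NeZero N'] {g : CuspForm (Gamma0 N') 2} {ϖ' : ℚ}
    (hp : 3 ≤ p) (hord : GoodOrd W p) (hK : IsImaginaryQuadratic K)
    (hsplit : ((Ideal.span {(p : ℤ)}).primesOver (𝓞 K)).ncard = 2)
    (hN : IsCoprime (N : ℤ) (NumberField.discr K)) (hκ₁ : κ₁.IsCyclotomic) (hκ₂ : κ₂.IsAnticyclotomic)
    (hγ₁ : IsCyclotomicVariable p (absGaloisRestrict ℚ K γ₁))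
    (hϖ : (ϖ : ℝ) * W.realPeriodRat = plusPeriod π.f)
    (hW' : ∃ C : WeierstrassCurve.VariableChange ℚ, C • W' = W.quadraticTwist (NumberField.discr K : ℚ))
    (hg : IsNewformOf W' g) (hϖ' : (ϖ' : ℝ) * W'.realPeriodRat = plusPeriod g)
    {F : CycAntiSeries p} (hF : IsHidaRankinLFunction ι W κ₁ κ₂ π.f F) :
    cycRestrict (perrinRiouLFunction W π F) = 0 ↔
      PowerSeries.C ((ϖ * ϖ' : ℚ) : ℚ_[p]) *
        (padicLFunction π.f (unitRoot W p : ℚ_[p]) * padicLFunction g (unitRoot W' p : ℚ_[p])) = 0 :=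
  (associated_cycRestrict_perrinRiou_of_prop37_mul h ι W κ₁ κ₂ γ₁ γ₂ π W' hp hord hK hsplit hN hκ₁ hκ₂
    hγ₁ hϖ hW' hg hϖ' hF).eq_zero_iff

end APIIntegral

end Literature.NumberTheory.EllipticCurves.YanZhu2026

end
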